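import Summits.HodgeConjecture.HodgeConjecture.Theorems.Ring2AbelianAllWeilCellsInhabited
import Summits.HodgeConjecture.HodgeConjecture.Theorems.Ring2AbelianAllWeilFloorRebase
import HarnessLib

/-!
# Ring 2 · AbelianAll (ab-weil-1, gen 8, part 3/3) — ATLAS CONSEQUENCES of the CM tower: the open cells of the
  imaginary-quadratic Weil column are statements about NON-EMPTY families; the empty components are exactly
  the gen-7 wrong-sign ones

research route, not a corollary; conditional on HC_CM plus one named minimal statement.
Cell line: research route conditional on HC_CM; not a corollary; Q11.4-sentence-2 already refuted in dim ≥ 3.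
`HC_CM` (`Theses.RankFourFaces.CMAbelianHodge`) does not occur in this file; nothing here proves a case of the
Hodge conjecture. Part 2 (`weilClassesComponent_inhabited_iff_sign`) made "`(n, d, δ)` inhabited ⟺
`sign δ = (-1)ⁿ`" a kernel theorem. This file spells out what that says about the ATLAS of gens 5–7:
* `inhabitedWeilComponents_eq_preimage_sign` — for `n ≥ 1`, `d ≥ 1` the set of discriminant classes `δ ∈ ℚˣ/Nm(K_dˣ)` realised
  by an embedded Weil-type `2n`-fold with a non-zero rational `(n,n)` Weil class is EXACTLY the coset
  `sign⁻¹((-1)ⁿ)`; its complement is exactly the set of components closed "vacuously" in gen 7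
  (`weilClassesComponent_of_weilSign_ne`), so gen 7's sign reduction `forall_weilClassesComponent_iff_sign` is sharp:
  no further component is closable by emptiness.
* `weilFourfoldComponent_inhabited` / `weilSixfoldComponent_inhabited` — every POSITIVE fourfold component
  `(2, d, δ)` and every NEGATIVE sixfold component `(3, d, δ)` is inhabited; in particular
  (`openFourfoldResidual_inhabited`, `openNonsplitSixfoldResidual_inhabited`) every cell in the two residual index
  sets that gen 7 hands to weil-2 — `{(2, d₀, δ) : d₀ squarefree ∉ {1,3}, δ > 0, δ ≠ [1]}` behind
  `hodgeConjectureFor_abelian_dim_le_five_of_refereed_and_positive_residualSq`, and `{(3, d₀, δ) : δ < 0, δ ≠ [-1]}`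
  behind `nonsplitSixfolds_of_negative_nonsplit_components` — is a statement about a non-empty set of polarized
  Weil-type abelian varieties carrying non-zero candidate classes: none of them is vacuous and none is a restatement
  of an empty case.
* `weilFourfoldComponent_empty_iff` / `weilSixfoldComponent_empty_iff` — a fourfold (sixfold) component is EMPTY iff
  its sign is `-1` (`+1`): cell by cell, "closed by emptiness in gen 7" and "inhabited" are complementary.

## References
* B. van Geemen, *An introduction to the Hodge conjecture for abelian varieties*, LNM 1594 (1994), 4.11, 4.14,
  Lemma 5.2, 5.3–5.5. [vanGeemen1994HodgeAV]
* E. Markman, *The monodromy of generalized Kummer varieties and algebraic cycles on their intermediate Jacobians*,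
  JEMS 25 (2023) no. 1, 231–321, Thm 1.5. [Markman2023GeneralizedKummers]
-/

noncomputable section

set_option linter.dupNamespace false

open CategoryTheory
open Literature.AlgebraicGeometry Literature.AlgebraicGeometry.Motives
open Literature.AlgebraicGeometry.HodgeTheory
open Literature.AlgebraicGeometry.VanGeemen1994
open Literature.AlgebraicTopology.SingularHomology
open Literature.Geometry.Kaehler
open Summit.HodgeConjecture.HodgeConjecture.Ring2.Hypotheses

namespace Summit.HodgeConjecture.HodgeConjecture.Ring2.AbelianAll

/-! Throughout, "`(n, d, δ)` is INHABITED" is the existential of part 2 (`weilClassesComponent_inhabited_iff_sign`),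
written out in full (no abbreviation is introduced): an abelian `2n`-fold `(A, φ)`, `φ ≫ φ = -d`, an embedding whose
`K`-symmetrised hyperplane class (on a non-zero rational ambient class) has non-degenerate discriminant class `δ`,
and a non-zero rational `(n,n)` class in its Weil plane — the premises of `Hypotheses.WeilClassesComponent n d δ`
met by a triple on which its conclusion is not void. -/

/-- **The inhabited components are exactly a coset of the sign kernel**: for `n ≥ 1`, `d ≥ 1`,
`{δ : (n, d, δ) inhabited} = sign⁻¹{(-1)ⁿ}`; the complement — the EMPTY components — is exactly the set gen 7 closed
vacuously (`weilClassesComponent_of_weilSign_ne`), so the sign reduction `forall_weilClassesComponent_iff_sign`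
cannot be pushed further by emptiness. [cite: vanGeemen1994HodgeAV, 4.11, 4.14 and Lemma 5.2 (4)] -/
theorem inhabitedWeilComponents_eq_preimage_sign {n d : ℕ} (hn : 0 < n) (hd : 0 < d) :
    {δ : weilNormResidueGroup d | ∃ (A : AbelianVariety ℂ) (φ : A ⟶ A) (e : ProjectiveEmbedding A.X)
        (a : complexBetti (projectiveSpace e.n ℂ) 2) (c : complexBetti A.X (2 * n)),
        A.dim = 2 * n ∧ IsSmoothProjective (2 * n) A.X ∧ φ ≫ φ = -(d • 𝟙 A) ∧ IsRationalClass a ∧ a ≠ 0 ∧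
          HasWeilDiscriminantNondeg A φ n d
            ((d : ℂ) • complexBetti.map e.ι 2 a + complexBetti.map φ.hom.hom.hom 2 (complexBetti.map e.ι 2 a)) δ ∧
          c ∈ weilClassesOf A φ n d ∧ IsRationalClass c ∧ IsOfHodgeType (2 * n) A.X (2 * n) n n c ∧ c ≠ 0} =
      weilSign d ⁻¹' {(-1) ^ n} :=
  Set.ext fun δ => by
    rw [Set.mem_setOf_eq, weilClassesComponent_inhabited_iff_sign hn hd, Set.mem_preimage, Set.mem_singleton_iff]

/-- On an INHABITED component the target `WeilClassesComponent n d δ` is a genuine statement: it yields a NON-ZERO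
algebraic Weil class on a named abelian `2n`-fold (so it is not an instance of an empty case).
[cite: vanGeemen1994HodgeAV, 4.11, 4.14 and 5.3] -/
theorem exists_ne_zero_algebraic_of_weilClassesComponent {n d : ℕ} {δ : weilNormResidueGroup d}
    (hI : ∃ (A : AbelianVariety ℂ) (φ : A ⟶ A) (e : ProjectiveEmbedding A.X)
      (a : complexBetti (projectiveSpace e.n ℂ) 2) (c : complexBetti A.X (2 * n)),
      A.dim = 2 * n ∧ IsSmoothProjective (2 * n) A.X ∧ φ ≫ φ = -(d • 𝟙 A) ∧ IsRationalClass a ∧ a ≠ 0 ∧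
        HasWeilDiscriminantNondeg A φ n d
          ((d : ℂ) • complexBetti.map e.ι 2 a + complexBetti.map φ.hom.hom.hom 2 (complexBetti.map e.ι 2 a)) δ ∧
        c ∈ weilClassesOf A φ n d ∧ IsRationalClass c ∧ IsOfHodgeType (2 * n) A.X (2 * n) n n c ∧ c ≠ 0)
    (hW : WeilClassesComponent n d δ) :
    ∃ (A : AbelianVariety ℂ) (φ : A ⟶ A) (c : complexBetti A.X (2 * n)),
      A.dim = 2 * n ∧ φ ≫ φ = -(d • 𝟙 A) ∧ c ∈ weilClassesOf A φ n d ∧ c ≠ 0 ∧ c ∈ algebraicClasses A.X n := by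
  obtain ⟨A, φ, e, a, c, hA, hX, hφ, ha, ha0, hN, hc, hcr, hcH, hc0⟩ := hI
  exact ⟨A, φ, c, hA, hφ, hc, hc0, hW A φ hA hX hφ e a ha ha0 hN c hcr hcH hc⟩

/-! ### The two residual index sets of the dim `≤ 5` floor are cellwise inhabited -/

/-- **Every POSITIVE fourfold component `(2, d, δ)`, `sign δ = +1`, is inhabited** (`d ≥ 1`): a Weil-type fourfold
with `det H = δ` carrying a non-zero rational `(2,2)` Weil class. [cite: vanGeemen1994HodgeAV, 4.11, 4.14 and 5.3] -/
theorem weilFourfoldComponent_inhabited {d : ℕ} (hd : 0 < d) {δ : weilNormResidueGroup d} (hδ : weilSign d δ = 1) :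
    ∃ (A : AbelianVariety ℂ) (φ : A ⟶ A) (e : ProjectiveEmbedding A.X)
      (a : complexBetti (projectiveSpace e.n ℂ) 2) (c : complexBetti A.X (2 * 2)),
      A.dim = 2 * 2 ∧ IsSmoothProjective (2 * 2) A.X ∧ φ ≫ φ = -(d • 𝟙 A) ∧ IsRationalClass a ∧ a ≠ 0 ∧
        HasWeilDiscriminantNondeg A φ 2 d
          ((d : ℂ) • complexBetti.map e.ι 2 a + complexBetti.map φ.hom.hom.hom 2 (complexBetti.map e.ι 2 a)) δ ∧
        c ∈ weilClassesOf A φ 2 d ∧ IsRationalClass c ∧ IsOfHodgeType (2 * 2) A.X (2 * 2) 2 2 c ∧ c ≠ 0 :=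
  (weilClassesComponent_inhabited_iff_sign two_pos hd δ).2 (hδ.trans (neg_one_sq : ((-1 : ℤˣ) ^ 2) = 1).symm)

/-- **Every NEGATIVE sixfold component `(3, d, δ)`, `sign δ = -1`, is inhabited** (`d ≥ 1`).
[cite: vanGeemen1994HodgeAV, 4.11, 4.14 and 5.3] -/
theorem weilSixfoldComponent_inhabited {d : ℕ} (hd : 0 < d) {δ : weilNormResidueGroup d} (hδ : weilSign d δ = -1) :
    ∃ (A : AbelianVariety ℂ) (φ : A ⟶ A) (e : ProjectiveEmbedding A.X)
      (a : complexBetti (projectiveSpace e.n ℂ) 2) (c : complexBetti A.X (2 * 3)),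
      A.dim = 2 * 3 ∧ IsSmoothProjective (2 * 3) A.X ∧ φ ≫ φ = -(d • 𝟙 A) ∧ IsRationalClass a ∧ a ≠ 0 ∧
        HasWeilDiscriminantNondeg A φ 3 d
          ((d : ℂ) • complexBetti.map e.ι 2 a + complexBetti.map φ.hom.hom.hom 2 (complexBetti.map e.ι 2 a)) δ ∧
        c ∈ weilClassesOf A φ 3 d ∧ IsRationalClass c ∧ IsOfHodgeType (2 * 3) A.X (2 * 3) 3 3 c ∧ c ≠ 0 :=
  (weilClassesComponent_inhabited_iff_sign three_pos hd δ).2 (hδ.trans ((by decide : Odd 3).neg_one_pow).symm)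

/-- **The open fourfold residual of the dim `≤ 5` floor is cellwise inhabited.** Every index of the residual premise
of `hodgeConjectureFor_abelian_dim_le_five_of_refereed_and_positive_residualSq` — `d` squarefree, `d ∉ {1, 3}`,
`δ ≠ [1]` (non-split), `sign δ = +1` — names a NON-EMPTY family of polarized Weil-type fourfolds with non-zero
rational `(2,2)` Weil classes: no cell of the residual is reducible by vacuity.
[cite: vanGeemen1994HodgeAV, 4.11, 4.14 and 5.3] [cite: Markman2023GeneralizedKummers, Thm 1.5] -/
theorem openFourfoldResidual_inhabited (d : ℕ) (hd : 0 < d) (_hsq : Squarefree d) (_h1 : d ≠ 1) (_h3 : d ≠ 3)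
    (δ : weilNormResidueGroup d) (_hns : δ ≠ splitDiscriminantClass 2 d) (hδ : weilSign d δ = 1) :
    ∃ (A : AbelianVariety ℂ) (φ : A ⟶ A) (e : ProjectiveEmbedding A.X)
      (a : complexBetti (projectiveSpace e.n ℂ) 2) (c : complexBetti A.X (2 * 2)),
      A.dim = 2 * 2 ∧ IsSmoothProjective (2 * 2) A.X ∧ φ ≫ φ = -(d • 𝟙 A) ∧ IsRationalClass a ∧ a ≠ 0 ∧
        HasWeilDiscriminantNondeg A φ 2 d
          ((d : ℂ) • complexBetti.map e.ι 2 a + complexBetti.map φ.hom.hom.hom 2 (complexBetti.map e.ι 2 a)) δ ∧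
        c ∈ weilClassesOf A φ 2 d ∧ IsRationalClass c ∧ IsOfHodgeType (2 * 2) A.X (2 * 2) 2 2 c ∧ c ≠ 0 :=
  weilFourfoldComponent_inhabited hd hδ

/-- **The open non-split sixfold residual is cellwise inhabited.** Every index of the residual behind
`nonsplitSixfolds_of_negative_nonsplit_components` — `δ ≠ [-1]` (non-split), `sign δ = -1` — names a non-empty
family of polarized Weil-type sixfolds with non-zero rational `(3,3)` Weil classes. [cite: vanGeemen1994HodgeAV, 4.11, 4.14 and 5.3] -/
theorem openNonsplitSixfoldResidual_inhabited (d : ℕ) (hd : 0 < d) (δ : weilNormResidueGroup d)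
    (_hns : δ ≠ splitDiscriminantClass 3 d) (hδ : weilSign d δ = -1) :
    ∃ (A : AbelianVariety ℂ) (φ : A ⟶ A) (e : ProjectiveEmbedding A.X)
      (a : complexBetti (projectiveSpace e.n ℂ) 2) (c : complexBetti A.X (2 * 3)),
      A.dim = 2 * 3 ∧ IsSmoothProjective (2 * 3) A.X ∧ φ ≫ φ = -(d • 𝟙 A) ∧ IsRationalClass a ∧ a ≠ 0 ∧
        HasWeilDiscriminantNondeg A φ 3 d
          ((d : ℂ) • complexBetti.map e.ι 2 a + complexBetti.map φ.hom.hom.hom 2 (complexBetti.map e.ι 2 a)) δ ∧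
        c ∈ weilClassesOf A φ 3 d ∧ IsRationalClass c ∧ IsOfHodgeType (2 * 3) A.X (2 * 3) 3 3 c ∧ c ≠ 0 :=
  weilSixfoldComponent_inhabited hd hδ

/-- **A fourfold component is EMPTY iff its sign is `-1`** (`d ≥ 1`) — exactly the cells gen 7 closed by
`weilClassesComponent_two_of_weilSign_eq_neg_one`. [cite: vanGeemen1994HodgeAV, 4.14 and Lemma 5.2 (4)] -/
theorem weilFourfoldComponent_empty_iff {d : ℕ} (hd : 0 < d) (δ : weilNormResidueGroup d) :
    (¬ ∃ (A : AbelianVariety ℂ) (φ : A ⟶ A) (e : ProjectiveEmbedding A.X)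
      (a : complexBetti (projectiveSpace e.n ℂ) 2) (c : complexBetti A.X (2 * 2)),
      A.dim = 2 * 2 ∧ IsSmoothProjective (2 * 2) A.X ∧ φ ≫ φ = -(d • 𝟙 A) ∧ IsRationalClass a ∧ a ≠ 0 ∧
        HasWeilDiscriminantNondeg A φ 2 d
          ((d : ℂ) • complexBetti.map e.ι 2 a + complexBetti.map φ.hom.hom.hom 2 (complexBetti.map e.ι 2 a)) δ ∧
        c ∈ weilClassesOf A φ 2 d ∧ IsRationalClass c ∧ IsOfHodgeType (2 * 2) A.X (2 * 2) 2 2 c ∧ c ≠ 0) ↔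
      weilSign d δ = -1 := by
  rw [(weilClassesComponent_inhabited_iff_sign two_pos hd δ).not,
    show ((-1 : ℤˣ) ^ (2 : ℕ)) = 1 from (neg_one_sq : ((-1 : ℤˣ) ^ 2) = 1)]
  rcases weilSign_eq_one_or d δ with h | h <;> rw [h] <;> decide

/-- **A sixfold component is EMPTY iff its sign is `+1`** (`d ≥ 1`) — exactly the cells gen 7 closed by
`weilClassesComponent_three_of_weilSign_eq_one`. [cite: vanGeemen1994HodgeAV, 4.14 and Lemma 5.2 (4)] -/
theorem weilSixfoldComponent_empty_iff {d : ℕ} (hd : 0 < d) (δ : weilNormResidueGroup d) :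
    (¬ ∃ (A : AbelianVariety ℂ) (φ : A ⟶ A) (e : ProjectiveEmbedding A.X)
      (a : complexBetti (projectiveSpace e.n ℂ) 2) (c : complexBetti A.X (2 * 3)),
      A.dim = 2 * 3 ∧ IsSmoothProjective (2 * 3) A.X ∧ φ ≫ φ = -(d • 𝟙 A) ∧ IsRationalClass a ∧ a ≠ 0 ∧
        HasWeilDiscriminantNondeg A φ 3 d
          ((d : ℂ) • complexBetti.map e.ι 2 a + complexBetti.map φ.hom.hom.hom 2 (complexBetti.map e.ι 2 a)) δ ∧
        c ∈ weilClassesOf A φ 3 d ∧ IsRationalClass c ∧ IsOfHodgeType (2 * 3) A.X (2 * 3) 3 3 c ∧ c ≠ 0) ↔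
      weilSign d δ = 1 := by
  rw [(weilClassesComponent_inhabited_iff_sign three_pos hd δ).not,
    show ((-1 : ℤˣ) ^ (3 : ℕ)) = -1 from (by decide : Odd 3).neg_one_pow]
  rcases weilSign_eq_one_or d δ with h | h <;> rw [h] <;> decide

end Summit.HodgeConjecture.HodgeConjecture.Ring2.AbelianAll

end
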